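import Summits.AnomalousDissipation.AnomalousDissipation.Theorems.MarginalStabilityChainBurgersLayerKHStubStrainedF

/-!
# Line `Sketch`, stub `stub_strained` (lead) — part G

part G: from the fixed point to a slow mode (`slowMode_of_fixedPoint`: `C⁴` bootstrap, vorticity `= Ω`, sheet
coefficient formula), the whole-line integral as the `y → -∞` limit of the Volterra operator (dominated convergence,
`norm_integral_le_of_volterra_bound`), and the Volterra form of an `h = 0` slow mode (`volterraForm_of_slowMode_zero`).
-/

set_option linter.dupNamespace false

noncomputable section

open Complex MeasureTheory Filter Topology Set Metric intervalIntegral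

namespace Summit.AnomalousDissipation.AnomalousDissipation.Theorems.BurgersLayerKH.Sheet.Strained

/-! ## §I From the fixed point to a slow mode -/

/-- If `m' = D` and `D' = 2α D + f`, then `ψ = e^{-αy} m` has
`ψ'' = α² ψ + e^{-αy} f` (cf. `RayleighJost.iteratedDeriv_two_psi`). [folklore] -/
theorem iteratedDeriv_two_weighted {α : ℝ} {f m D : ℝ → ℂ} (h1 : ∀ y, HasDerivAt m (D y) y)
    (h2 : ∀ y, HasDerivAt D (2 * α * D y + f y) y) (y : ℝ) :
    iteratedDeriv 2 (fun x => (Real.exp (-(α * x)) : ℂ) * m x) y =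
      (α : ℂ) ^ 2 * ((Real.exp (-(α * y)) : ℂ) * m y) + (Real.exp (-(α * y)) : ℂ) * f y := by
  have he : ∀ x, HasDerivAt (fun x => (Real.exp (-(α * x)) : ℂ))
      ((Real.exp (-(α * x)) * -α : ℝ) : ℂ) x := by
    intro x
    have h1 : HasDerivAt (fun x : ℝ => -(α * x)) (-α) x :=
      (hasDerivAt_mul_const (-α)).congr_of_eventuallyEq (Eventually.of_forall fun y => by ring)
    exact h1.exp.ofReal_comp
  have hψ1 : ∀ x, HasDerivAt (fun x => (Real.exp (-(α * x)) : ℂ) * m x)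
      ((Real.exp (-(α * x)) : ℂ) * (D x - α * m x)) x := by
    intro x
    refine ((he x).fun_mul (h1 x)).congr_deriv ?_
    push_cast
    ring
  have hd1 : deriv (fun x => (Real.exp (-(α * x)) : ℂ) * m x) =
      fun x => (Real.exp (-(α * x)) : ℂ) * (D x - α * m x) :=
    funext fun x => (hψ1 x).deriv
  have hψ2 : HasDerivAt (fun x => (Real.exp (-(α * x)) : ℂ) * (D x - α * m x))
      ((α : ℂ) ^ 2 * ((Real.exp (-(α * y)) : ℂ) * m y) + (Real.exp (-(α * y)) : ℂ) * f y) y := by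
    refine ((he y).fun_mul ((h2 y).fun_sub ((h1 y).const_mul (α : ℂ)))).congr_deriv ?_
    push_cast
    ring
  rw [iteratedDeriv_succ, iteratedDeriv_one, hd1, hψ2.deriv]

/-- Smoothness bootstrap: if `m' = D`, `D' = 2αD + f` with `f ∈ C²`, then `m ∈ C⁴`. [folklore] -/
theorem contDiff_four_of_volterra {α : ℝ} {f m D : ℝ → ℂ} (hf : ContDiff ℝ 2 f)
    (h1 : ∀ y, HasDerivAt m (D y) y) (h2 : ∀ y, HasDerivAt D (2 * α * D y + f y) y) : ContDiff ℝ 4 m := by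
  have hdm : deriv m = D := funext fun y => (h1 y).deriv
  have hdD : deriv D = fun y => 2 * α * D y + f y := funext fun y => (h2 y).deriv
  have hmd : Differentiable ℝ m := fun y => (h1 y).differentiableAt
  have hDd : Differentiable ℝ D := fun y => (h2 y).differentiableAt
  have hD1 : ContDiff ℝ 1 D := by
    rw [contDiff_one_iff_deriv]
    refine ⟨hDd, ?_⟩
    rw [hdD]
    exact (continuous_const.mul hDd.continuous).add hf.continuous
  have hD2 : ContDiff ℝ 2 D := by
    rw [show (2 : WithTop ℕ∞) = 1 + 1 from rfl, contDiff_succ_iff_deriv]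
    refine ⟨hDd, by simp, ?_⟩
    rw [hdD]
    exact (contDiff_const.mul hD1).add (hf.of_le (by norm_num))
  have hD3 : ContDiff ℝ 3 D := by
    rw [show (3 : WithTop ℕ∞) = 2 + 1 from rfl, contDiff_succ_iff_deriv]
    refine ⟨hDd, by simp, ?_⟩
    rw [hdD]
    exact (contDiff_const.mul hD2).add hf
  rw [show (4 : WithTop ℕ∞) = 3 + 1 from rfl, contDiff_succ_iff_deriv]
  exact ⟨hmd, by simp, by rw [hdm]; exact hD3⟩

/-- **The fixed point is a slow mode.** If `m` is continuous of linear growth,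
`Ω` is a Gaussian-class resolvent solution at `(α, h, λ)` with source `-iU'' e^{-αt} m`, and
`m = 1 - ∫_{t>y} k_α(t-y) e^{αt} Ω(t) dt`, then `ψ := e^{-αy} m` is a slow mode with vorticity `Ω`,
and `sheetCoeff α ψ = 1 - (2α)⁻¹ ∫ e^{αt} Ω`. [folklore] -/
theorem slowMode_of_fixedPoint {α h B : ℝ} (hα : 0 < α) {lam : ℂ} {m Ω : ℝ → ℂ}
    (hmb : ∀ y, ‖m y‖ ≤ B * (1 + |y|))
    (hΩ : IsResolventSol α h lam (fun t => -(I * Upp t) * ((Real.exp (-(α * t)) : ℂ) * m t)) Ω)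
    (hm : ∀ y, m y = 1 - ∫ t in Ioi y, (volterraKernel α (t - y) : ℂ) * ((Real.exp (α * t) : ℂ) * Ω t)) :
    IsSlowMode α h lam (fun y => (Real.exp (-(α * y)) : ℂ) * m y) ∧
      vort α (fun y => (Real.exp (-(α * y)) : ℂ) * m y) = Ω ∧
      sheetCoeff α (fun y => (Real.exp (-(α * y)) : ℂ) * m y) =
        1 - (1 / (2 * (α : ℂ))) * ∫ t : ℝ, (Real.exp (α * t) : ℂ) * Ω t := by
  obtain ⟨hΩc2, ⟨CΩ, hCΩ⟩, heq⟩ := hΩ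
  have hCΩ0 : 0 ≤ CΩ := GaussBound.nonneg hCΩ
  -- the source `f = -e^{αt} Ω` of the Volterra equation
  set f : ℝ → ℂ := fun t => -((Real.exp (α * t) : ℂ) * Ω t) with hf
  have hfc2 : ContDiff ℝ 2 f := by
    have hE : ContDiff ℝ 2 (fun t : ℝ => (Real.exp (α * t) : ℂ)) :=
      ofRealCLM.contDiff.comp (by fun_prop : ContDiff ℝ 2 fun t : ℝ => Real.exp (α * t))
    exact (hE.mul hΩc2).neg
  have hfc : Continuous f := hfc2.continuous
  have hfb : ∀ t, ‖f t‖ ≤ CΩ * ((1 + |t|) ^ 0 * Real.exp (α * t) * Real.exp (-(t ^ 2) / 4)) := by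
    intro t
    simp only [hf, pow_zero, one_mul]
    rw [norm_neg, norm_mul, Complex.norm_real, Real.norm_of_nonneg (Real.exp_pos _).le]
    calc Real.exp (α * t) * ‖Ω t‖ ≤ Real.exp (α * t) * (CΩ * Real.exp (-(t ^ 2) / 4)) :=
          mul_le_mul_of_nonneg_left (hCΩ t) (Real.exp_pos _).le
      _ = CΩ * (Real.exp (α * t) * Real.exp (-(t ^ 2) / 4)) := by ring
  obtain ⟨hfi, hgi⟩ := integrable_peg hfc hfb (-(2 * α))
  have hgi' : Integrable fun t => (Real.exp (-(2 * α * t)) : ℂ) * f t := by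
    refine hgi.congr (Filter.Eventually.of_forall fun t => ?_); simp only; congr 2; ring
  have hm' : ∀ y, m y = 1 + ∫ t in Ioi y, (volterraKernel α (t - y) : ℂ) * f t := by
    intro y
    rw [hm y, sub_eq_add_neg, ← MeasureTheory.integral_neg]
    congr 1
    exact integral_congr_ae (Filter.Eventually.of_forall fun t => by simp only [hf]; ring)
  obtain ⟨D, hD, hDd, -, hlim⟩ := volterra_regularity hα hfc hfi hgi' 1 hm'
  -- regularity and the vorticity
  have hm4 : ContDiff ℝ 4 m := contDiff_four_of_volterra hfc2 hD hDd
  have hexp : ContDiff ℝ 4 (fun x => (Real.exp (-(α * x)) : ℂ)) :=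
    ofRealCLM.contDiff.comp (by fun_prop : ContDiff ℝ 4 fun x => Real.exp (-(α * x)))
  have hψ4 : ContDiff ℝ 4 (fun y => (Real.exp (-(α * y)) : ℂ) * m y) := hexp.mul hm4
  have hweight : ∀ y, (Real.exp (α * y) : ℂ) * ((Real.exp (-(α * y)) : ℂ) * m y) = m y := by
    intro y
    rw [← mul_assoc, ← Complex.ofReal_mul, ← Real.exp_add, add_neg_cancel, Real.exp_zero,
      Complex.ofReal_one, one_mul]
  have hweight' : ∀ y, (Real.exp (-(α * y)) : ℂ) * (Real.exp (α * y) : ℂ) = 1 := by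
    intro y
    rw [← Complex.ofReal_mul, ← Real.exp_add, neg_add_cancel, Real.exp_zero, Complex.ofReal_one]
  have hvort : vort α (fun y => (Real.exp (-(α * y)) : ℂ) * m y) = Ω := by
    funext y
    rw [vort, iteratedDeriv_two_weighted hD hDd y]
    simp only [hf]
    linear_combination (Ω y) * hweight' y
  refine ⟨⟨hψ4, fun y => ?_, ⟨CΩ, by rw [hvort]; exact hCΩ⟩, ?_, ⟨B, fun y => by rw [hweight]; exact hmb y⟩⟩,
    hvort, ?_⟩
  · -- the equation
    rw [hvort]
    exact heq y
  · -- normalisation at `+∞`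
    have hfun : (fun y => (Real.exp (α * y) : ℂ) * ((Real.exp (-(α * y)) : ℂ) * m y)) = m := funext hweight
    rw [hfun]; exact hlim
  · -- the sheet coefficient
    rw [sheetCoeff, hvort]

/-! ## §K The whole-line integral as the `y → -∞` limit of the Volterra operator -/

/-- **`∫_ℝ e^{αt} g = 2α · lim_{y→-∞} ∫_{t>y} k_α(t-y) e^{αt} g(t) dt`** for a continuous `g` of the class
`‖g t‖ ≤ M(1+|t|)^n e^{-t²/4}` (dominated convergence: `k_α(t-y) ↑ 1/(2α)`). [folklore] -/
theorem tendsto_volterra_atBot {α M : ℝ} (hα : 0 < α) {n : ℕ} {g : ℝ → ℂ} (hgc : Continuous g)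
    (hgb : ∀ t, ‖g t‖ ≤ M * ((1 + |t|) ^ n * Real.exp (-(t ^ 2) / 4))) :
    Tendsto (fun y => ∫ t in Ioi y, (volterraKernel α (t - y) : ℂ) * ((Real.exp (α * t) : ℂ) * g t)) atBot
      (𝓝 ((1 / (2 * α) : ℂ) * ∫ t : ℝ, (Real.exp (α * t) : ℂ) * g t)) := by
  -- the integrand on the whole line, as an indicator
  set G : ℝ → ℂ := fun t => (Real.exp (α * t) : ℂ) * g t with hG
  have hGc : Continuous G := by simp only [hG]; fun_prop
  have hGb : ∀ t, ‖G t‖ ≤ M * ((1 + |t|) ^ n * Real.exp (α * t) * Real.exp (-(t ^ 2) / 4)) := by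
    intro t; simp only [hG]
    rw [norm_mul, Complex.norm_real, Real.norm_of_nonneg (Real.exp_pos _).le]
    calc Real.exp (α * t) * ‖g t‖ ≤ Real.exp (α * t) * (M * ((1 + |t|) ^ n * Real.exp (-(t ^ 2) / 4))) :=
          mul_le_mul_of_nonneg_left (hgb t) (Real.exp_pos _).le
      _ = M * ((1 + |t|) ^ n * Real.exp (α * t) * Real.exp (-(t ^ 2) / 4)) := by ring
  obtain ⟨hGi, -⟩ := integrable_peg hGc hGb 0
  set Φ : ℝ → ℝ → ℂ := fun y t => (Ioi y).indicator (fun t => (volterraKernel α (t - y) : ℂ) * G t) t with hΦ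
  have hrepr : ∀ y, (∫ t in Ioi y, (volterraKernel α (t - y) : ℂ) * ((Real.exp (α * t) : ℂ) * g t)) = ∫ t, Φ y t := by
    intro y; simp only [hΦ]; rw [MeasureTheory.integral_indicator measurableSet_Ioi]
  simp_rw [hrepr]
  rw [← MeasureTheory.integral_const_mul]
  refine tendsto_integral_filter_of_dominated_convergence (fun t => 1 / (2 * α) * ‖G t‖) ?_ ?_ ?_ ?_
  · -- measurability
    refine Filter.Eventually.of_forall fun y => ?_
    have hkc : Continuous fun t => (volterraKernel α (t - y) : ℂ) := by
      have : (fun t => (volterraKernel α (t - y) : ℂ)) =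
          fun t => (((1 - Real.exp (-(2 * α * (t - y)))) / (2 * α) : ℝ) : ℂ) := by
        funext t; rw [volterraKernel_of_ne hα.ne']
      rw [this]; fun_prop
    exact ((hkc.mul hGc).aestronglyMeasurable).indicator measurableSet_Ioi
  · -- domination
    refine Filter.Eventually.of_forall fun y => ae_of_all _ fun t => ?_
    simp only [hΦ, Set.indicator]
    split_ifs with ht
    · obtain ⟨hk0, hk1⟩ := volterraKernel_bounds hα (sub_nonneg.2 (le_of_lt ht))
      rw [norm_mul, Complex.norm_of_nonneg hk0]
      exact mul_le_mul_of_nonneg_right hk1 (norm_nonneg _)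
    · rw [norm_zero]; positivity
  · exact hGi.norm.const_mul _
  · -- pointwise convergence
    refine ae_of_all _ fun t => ?_
    have hk : Tendsto (fun y => (volterraKernel α (t - y) : ℂ)) atBot (𝓝 ((1 / (2 * α) : ℂ))) := by
      have h1 : Tendsto (fun y => -(2 * α * (t - y))) atBot atBot := by
        have : Tendsto (fun y => 2 * α * y + -(2 * α * t)) atBot atBot :=
          tendsto_atBot_add_const_right _ _ (Tendsto.const_mul_atBot (by positivity) tendsto_id)
        refine this.congr fun y => by ring
      have h2 : Tendsto (fun y => Real.exp (-(2 * α * (t - y)))) atBot (𝓝 0) := Real.tendsto_exp_atBot.comp h1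
      have h3 : Tendsto (fun y => (1 - Real.exp (-(2 * α * (t - y)))) / (2 * α)) atBot (𝓝 ((1 - 0) / (2 * α))) :=
        (tendsto_const_nhds.sub h2).div_const _
      have h4 : Tendsto (fun y => volterraKernel α (t - y)) atBot (𝓝 (1 / (2 * α))) := by
        simp only [sub_zero] at h3
        refine h3.congr fun y => ?_
        rw [volterraKernel_of_ne hα.ne']
      have := (Complex.continuous_ofReal.tendsto _).comp h4
      refine (this.congr fun y => rfl).trans ?_
      simp
    have hev : ∀ᶠ y in atBot, Φ y t = (volterraKernel α (t - y) : ℂ) * G t := by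
      filter_upwards [eventually_lt_atBot t] with y hy
      simp only [hΦ, Set.indicator, Set.mem_Ioi, if_pos hy]
    refine Tendsto.congr' (EventuallyEq.symm hev) ?_
    exact hk.mul tendsto_const_nhds

/-- **Whole-line bound from a uniform half-line bound.** [folklore] -/
theorem norm_integral_le_of_volterra_bound {α M Cb : ℝ} (hα : 0 < α) {n : ℕ} {g : ℝ → ℂ} (hgc : Continuous g)
    (hgb : ∀ t, ‖g t‖ ≤ M * ((1 + |t|) ^ n * Real.exp (-(t ^ 2) / 4)))
    (hb : ∀ y, ‖∫ t in Ioi y, (volterraKernel α (t - y) : ℂ) * ((Real.exp (α * t) : ℂ) * g t)‖ ≤ Cb) :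
    ‖∫ t : ℝ, (Real.exp (α * t) : ℂ) * g t‖ ≤ 2 * α * Cb := by
  have hlim := tendsto_volterra_atBot hα hgc hgb
  have hle : ‖(1 / (2 * α) : ℂ) * ∫ t : ℝ, (Real.exp (α * t) : ℂ) * g t‖ ≤ Cb :=
    le_of_tendsto ((continuous_norm.tendsto _).comp hlim) (Filter.Eventually.of_forall hb)
  rw [norm_mul] at hle
  have h2 : ‖(1 / (2 * α) : ℂ)‖ = 1 / (2 * α) := by
    rw [show (1 / (2 * α) : ℂ) = ((1 / (2 * α) : ℝ) : ℂ) by push_cast; ring, Complex.norm_real,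
      Real.norm_of_nonneg (by positivity)]
  rw [h2] at hle
  rw [one_div, inv_mul_le_iff₀ (by positivity)] at hle
  linarith

/-! ## §J The `h = 0` slow mode in Volterra form -/

/-- A function with identically vanishing derivative on `ℝ` is constant. [folklore] -/
theorem eq_of_hasDerivAt_zero {φ : ℝ → ℂ} (h : ∀ y, HasDerivAt φ 0 y) (y : ℝ) : φ y = φ 0 := by
  have hd : Differentiable ℝ φ := fun y => (h y).differentiableAt
  exact is_const_of_deriv_eq_zero hd (fun y => (h y).deriv) y 0

/-- **Volterra form of an `h = 0` slow mode.** For `α > 0`, `re λ > 0` and a slow mode `ψ` at `h = 0`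
(a Jost solution of Rayleigh's equation), `m = e^{αy}ψ` satisfies
`m(y) = 1 - ∫_{t>y} k_α(t-y) e^{αt} ω(t) dt` with `ω = vort α ψ`: both sides solve `X'' - 2αX' = -e^{αy}ω`
and tend to `1`, and the difference of two such functions is `a + b e^{2αy}`. [folklore] -/
theorem volterraForm_of_slowMode_zero {α : ℝ} (hα : 0 < α) {lam : ℂ} {ψ : ℝ → ℂ}
    (hψ : IsSlowMode α 0 lam ψ) (y : ℝ) :
    (Real.exp (α * y) : ℂ) * ψ y =
      1 - ∫ t in Ioi y, (volterraKernel α (t - y) : ℂ) * ((Real.exp (α * t) : ℂ) * vort α ψ t) := by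
  obtain ⟨hC4, -, ⟨C, hG⟩, hlim, -⟩ := hψ
  have hC0 : 0 ≤ C := GaussBound.nonneg hG
  -- derivatives of `ψ`
  have hψd : Differentiable ℝ ψ := hC4.differentiable (by norm_num)
  have hψ3 : ContDiff ℝ 3 (deriv ψ) := (show ContDiff ℝ (3 + 1) ψ from hC4).deriv'
  have hψd' : Differentiable ℝ (deriv ψ) := hψ3.differentiable (by norm_num)
  have hψ2 : ContDiff ℝ 2 (deriv (deriv ψ)) := (show ContDiff ℝ (2 + 1) (deriv ψ) from hψ3).deriv'
  have hωc2 : ContDiff ℝ 2 (vort α ψ) := by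
    have : vort α ψ = fun y => -(deriv (deriv ψ) y - (α : ℂ) ^ 2 * ψ y) := by
      funext y; rw [vort, iteratedDeriv_two_eq]
    rw [this]
    exact (hψ2.sub (contDiff_const.mul (hC4.of_le (by norm_num)))).neg
  have hω : ∀ y, vort α ψ y = -(deriv (deriv ψ) y - (α : ℂ) ^ 2 * ψ y) := fun y => by
    rw [vort, iteratedDeriv_two_eq]
  -- `m = e^{αy} ψ`, `m₁ = m'`
  set E : ℝ → ℂ := fun y => (Real.exp (α * y) : ℂ) with hE
  have hEd : ∀ y, HasDerivAt E (E y * α) y := fun y => by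
    have := (hasDerivAt_expLin α y).ofReal_comp
    simp only [hE]
    refine this.congr_deriv ?_
    push_cast; ring
  set m : ℝ → ℂ := fun y => E y * ψ y with hm
  set m₁ : ℝ → ℂ := fun y => E y * (deriv ψ y + α * ψ y) with hm₁
  set f : ℝ → ℂ := fun y => -(E y * vort α ψ y) with hf
  have hmD : ∀ y, HasDerivAt m (m₁ y) y := by
    intro y
    refine ((hEd y).mul (hψd y).hasDerivAt).congr_deriv ?_
    simp only [hm₁]; ring
  have hm₁D : ∀ y, HasDerivAt m₁ (2 * α * m₁ y + f y) y := by
    intro y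
    have := (hEd y).mul (((hψd' y).hasDerivAt).add (((hψd y).hasDerivAt).const_mul (α : ℂ)))
    refine this.congr_deriv ?_
    simp only [hm₁, hf, hω, Pi.add_apply]
    ring
  -- the Volterra candidate `m̃ = 1 + ∫ k f`
  have hfc : Continuous f := by
    have := hωc2.continuous
    simp only [hf, hE]; fun_prop
  have hfb : ∀ t, ‖f t‖ ≤ C * ((1 + |t|) ^ 0 * Real.exp (α * t) * Real.exp (-(t ^ 2) / 4)) := by
    intro t
    simp only [hf, hE, pow_zero, one_mul]
    rw [norm_neg, norm_mul, Complex.norm_real, Real.norm_of_nonneg (Real.exp_pos _).le]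
    calc Real.exp (α * t) * ‖vort α ψ t‖ ≤ Real.exp (α * t) * (C * Real.exp (-(t ^ 2) / 4)) :=
          mul_le_mul_of_nonneg_left (hG t) (Real.exp_pos _).le
      _ = C * (Real.exp (α * t) * Real.exp (-(t ^ 2) / 4)) := by ring
  obtain ⟨hfi, hgi⟩ := integrable_peg hfc hfb (-(2 * α))
  have hgi' : Integrable fun t => (Real.exp (-(2 * α * t)) : ℂ) * f t := by
    refine hgi.congr (Filter.Eventually.of_forall fun t => ?_); simp only; congr 2; ring
  set mt : ℝ → ℂ := fun y => 1 + ∫ t in Ioi y, (volterraKernel α (t - y) : ℂ) * f t with hmt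
  obtain ⟨Dt, hDt, hDtd, -, hlimt⟩ := volterra_regularity hα hfc hfi hgi' 1 (m := mt) (fun y => rfl)
  -- `ρ = m₁ - D̃` solves `ρ' = 2αρ`, hence `ρ = ρ(0) e^{2αy}`
  set ρ : ℝ → ℂ := fun y => m₁ y - Dt y with hρ
  have hρd : ∀ y, HasDerivAt ρ (2 * α * ρ y) y := by
    intro y
    refine ((hm₁D y).sub (hDtd y)).congr_deriv ?_
    simp only [hρ]; ring
  have hE2d : ∀ y, HasDerivAt (fun y => (Real.exp (-(2 * α * y)) : ℂ)) ((Real.exp (-(2 * α * y)) * (-(2 * α)) : ℝ) : ℂ) y := by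
    intro y
    have h1 : HasDerivAt (fun y => -(2 * α * y)) (-(2 * α)) y := by
      have := hasDerivAt_negLin α 0 y; simpa using this
    exact h1.exp.ofReal_comp
  have hρE : ∀ y, ρ y = (Real.exp (2 * α * y) : ℂ) * ρ 0 := by
    intro y
    have hconst : ∀ y, HasDerivAt (fun y => (Real.exp (-(2 * α * y)) : ℂ) * ρ y) 0 y := by
      intro y
      refine ((hE2d y).mul (hρd y)).congr_deriv ?_
      push_cast; ring
    have := eq_of_hasDerivAt_zero hconst y
    simp only [mul_zero, neg_zero, Real.exp_zero, Complex.ofReal_one, one_mul] at this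
    have hEE : (Real.exp (2 * α * y) : ℂ) * (Real.exp (-(2 * α * y)) : ℂ) = 1 := by
      rw [← Complex.ofReal_mul, ← Real.exp_add, add_neg_cancel, Real.exp_zero, Complex.ofReal_one]
    calc ρ y = ((Real.exp (2 * α * y) : ℂ) * (Real.exp (-(2 * α * y)) : ℂ)) * ρ y := by rw [hEE, one_mul]
      _ = (Real.exp (2 * α * y) : ℂ) * ρ 0 := by rw [mul_assoc, this]
  -- `φ = m - m̃` : `φ' = ρ(0) e^{2αy}`, so `φ = φ 0 + ρ 0 (e^{2αy} - 1)/(2α)`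
  set φ : ℝ → ℂ := fun y => m y - mt y with hφ
  have hαc : (α : ℂ) ≠ 0 := by exact_mod_cast hα.ne'
  have hα2 : (2 * (α : ℂ)) ≠ 0 := mul_ne_zero two_ne_zero hαc
  have hφform : ∀ y, φ y = φ 0 + ρ 0 * ((Real.exp (2 * α * y) : ℂ) - 1) / (2 * α) := by
    intro y
    have hconst : ∀ y, HasDerivAt (fun y => φ y - ρ 0 * (Real.exp (2 * α * y) : ℂ) / (2 * α)) 0 y := by
      intro y
      have h1 : HasDerivAt φ (ρ y) y := (hmD y).sub (hDt y)
      have h2 : HasDerivAt (fun y => (Real.exp (2 * α * y) : ℂ)) ((Real.exp (2 * α * y) * (2 * α) : ℝ) : ℂ) y :=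
        (hasDerivAt_expLin (2 * α) y).ofReal_comp
      refine (h1.sub ((h2.const_mul (ρ 0)).div_const (2 * (α : ℂ)))).congr_deriv ?_
      rw [hρE y]
      simp only [Complex.ofReal_mul, Complex.ofReal_ofNat]
      field_simp
      ring
    have := eq_of_hasDerivAt_zero hconst y
    simp only [mul_zero, Real.exp_zero, Complex.ofReal_one] at this
    have e : φ y = φ 0 - ρ 0 * 1 / (2 * α) + ρ 0 * (Real.exp (2 * α * y) : ℂ) / (2 * α) := by
      linear_combination this
    rw [e]; ring
  -- `φ → 0`, hence `ρ 0 = 0` and `φ ≡ 0`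
  have hφlim : Tendsto φ atTop (𝓝 0) := by
    have : Tendsto (fun y => m y - mt y) atTop (𝓝 (1 - 1)) := hlim.sub hlimt
    rw [sub_self] at this
    exact this
  have hρ0 : ρ 0 = 0 := by
    by_contra hne
    -- `e^{2αy} = (φ y - φ 0) (2α)/ρ 0 + 1` would converge
    have hexpr : ∀ y, ((Real.exp (2 * α * y) : ℝ) : ℂ) = (φ y - φ 0) * (2 * α) / ρ 0 + 1 := by
      intro y
      rw [hφform y]
      field_simp
      ring
    have hconv : Tendsto (fun y => ((Real.exp (2 * α * y) : ℝ) : ℂ)) atTop (𝓝 ((0 - φ 0) * (2 * α) / ρ 0 + 1)) := by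
      have := ((hφlim.sub_const (φ 0)).mul_const (2 * (α : ℂ))).div_const (ρ 0) |>.add_const 1
      refine this.congr fun y => ?_
      rw [hexpr y]
    have hre : Tendsto (fun y => Real.exp (2 * α * y)) atTop (𝓝 ((0 - φ 0) * (2 * α) / ρ 0 + 1).re) := by
      have := (Complex.continuous_re.tendsto _).comp hconv
      refine this.congr fun y => ?_
      simp only [Function.comp_apply, Complex.ofReal_re]
    have hdiv : Tendsto (fun y => Real.exp (2 * α * y)) atTop atTop :=
      Real.tendsto_exp_atTop.comp (Tendsto.const_mul_atTop (by positivity) tendsto_id)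
    exact not_tendsto_atTop_of_tendsto_nhds hre hdiv
  have hφconst : ∀ y, φ y = φ 0 := by
    intro y; rw [hφform y, hρ0]; ring
  have hφ0 : φ 0 = 0 := by
    have : Tendsto φ atTop (𝓝 (φ 0)) := tendsto_const_nhds.congr fun y => (hφconst y).symm
    exact tendsto_nhds_unique this hφlim
  have hmy : m y = mt y := by
    have := hφconst y
    rw [hφ0] at this
    simp only [hφ] at this
    exact sub_eq_zero.1 this
  -- conclusion
  simp only [hm, hmt, hE, hf] at hmy
  rw [hmy, sub_eq_add_neg, ← MeasureTheory.integral_neg]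
  congr 1
  exact integral_congr_ae (Filter.Eventually.of_forall fun t => by simp only; ring)

end Summit.AnomalousDissipation.AnomalousDissipation.Theorems.BurgersLayerKH.Sheet.Strained

end
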